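import Literature.LinearAlgebra.Matrix.LatimerMacDuffeeStableLattices
import Literature.LinearAlgebra.SemisimpleSimilarityCharpoly
import HarnessLib

/-!
# Marseglia's generalized Latimer–MacDuffee–Taussky theorem: the `GL_N(ℤ)`-conjugacy classes of integer matrices
# with SQUARE-FREE minimal polynomial `m` and characteristic polynomial `c` are the isomorphism classes of the
# `ℤ[x]/(m)`-lattices in the semisimple `ℚ[x]`-module with characteristic polynomial `c`
# (Marseglia 2019 Thm. 8.1 = Marseglia 2025 (ANTS XVI) Thm. 4.1)

[topic LinearAlgebra/Matrix] Lane `lit-hodgefound` (Track 2 foundations library), seat p15 generation 38, row g38-#3.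
Assembles g38-#1 `LatimerMacDuffeeStableLattices` (the correspondence for an arbitrary `(V, T)`: integer forms of
`(V,T)` mod `GLₙ(ℤ)` ↔ `T`-stable full lattices mod `C(T)`) with g38-#2 `SemisimpleSimilarityCharpoly` (semisimple +
equal characteristic polynomial ⟹ similar).  THEOREMS ONLY (no definition, no instance, no named fact; D-0026 net
Literature debt `0`; no `sorry`).  The tree's `LatimerMacDuffeeRegularMatrices` ∕ `LatimerMacDuffeeSquarefree` (HL Thm.
6.2, regular matrices; finiteness for square-free CHARACTERISTIC polynomial, «the case `h = m`») are the special cases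
`c = m`.

## Sources, VERBATIM

S. Marseglia, *Computing the ideal class monoid of an order*, J. Lond. Math. Soc. 101 (2020) [Marseglia2019], §8 (held
`paper:arxiv-1805.09671`, chunks p0014–p0015): «In what follows we will describe how to compute the representatives of
the conjugacy classes when the minimal polynomial is square-free. Our result is a generalization of [LaClMD33], where
the authors treat the case `m = c`, which was then re-proved with a different method in [taussky49], with the extra
assumption that `m = c` is irreducible. […] Let `f₁, …, f_r` be a collection of distinct irreducible monic polynomials
with integer coefficients and let `e₁, …, e_t` be positive integers such that `m = ∏ f_i`, `c = ∏ f_i^{e_i}`. Put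
`N = deg(c)` and denote by `𝓜_{m,c}(ℤ)` the set of integral `N × N` matrices with minimal and characteristic polynomials
`m` and `c`, respectively. For every `i = 1, …, r` put `K_i = ℚ[x]/(f_i)` and let `Δ_i` be the diagonal embedding of
`K_i` into `K_i^{e_i}`. Define `Δ` as the product map `∏_i Δ_i` with codomain `K = ∏_i K_i^{e_i}`. Observe that the order
`R₀ = ℤ[x]/(m)` has total quotient ring the `ℚ`-algebra `∏_i K_i`. Denote with `R` the image of `R₀` in `K` via `Δ` and
put `α = Δ(x mod (m))`. Let `𝓛(R, K)` be the set of full lattices in `K` which are `R`-modules […]. **Theorem 8.1.** The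
association `Φ : I ↦ [A(I, w̄)]_{∼_ℤ}` induces a bijection `Φ̃ : 𝓛(R, K)/≃_R → 𝓜_{m,c}(ℤ)/∼_ℤ`. *Proof.* […] Let `A`
be a matrix in `𝓜_{m,c}(ℤ)`. Note that since `m` is square-free then `A` is semisimple. […] Since `A` is semisimple
there is a decomposition `V = W₁ ⊕ … ⊕ W_r` into `ℚ`-vector spaces which are stable under the action of `α`, and
possibly after renumbering we can assume that `A|_{W_i}` has minimal polynomial `f_i` and hence that `W_i` is a
`K_i`-vector space. […] `W_i` must have dimension `e_i`. This concludes the proof that `I ∈ 𝓛(R, K)`.»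

S. Marseglia, *Modules over orders, conjugacy classes of integral matrices, and abelian varieties over finite fields*,
Res. Number Theory 11 (2025) (ANTS XVI) [Marseglia2025ModulesOverOrders], §4 (held `paper:arxiv-2208.05409`, chunk
p0009): «Let `m` be a squarefree polynomial in `ℤ[x]` […] `m = m₁⋯m_n` […] `h = m₁^{s₁}⋯m_n^{s_n}`. Denote by `Mat_{m,h}`
the set of integral square matrices with minimal polynomial `m` and characteristic polynomial `h`. Since `m` is
squarefree, these matrices are semisimple. Consider the étale algebra `K = ℚ[x]/m`, and the order `R = ℤ[π]` […].
Define `V = K₁^{s₁} ⊕ … ⊕ K_n^{s_n}`. As before, `𝓛(R, V)` denotes the category of `ℤ`-lattices in `V` which are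
`R`-modules. […] **Theorem 4.1** [MarICM18]. The function `Ψ` induces a bijection between the isomorphism classes in
`𝓛(R, V)` and `Mat_{m,h}/∼_ℤ`.»

## What is formalised

The pair `(K, α)` ∕ `(V, π)` of the sources is a SEMISIMPLE `ℚ[x]`-module with characteristic polynomial `c`; by
g38-#2 any two such are isomorphic, so we state the theorem for an ARBITRARY finite-dimensional `ℚ`-space `V` with a
SEMISIMPLE `T ∈ End V` such that `χ_T = c` (the printed `K = ∏ K_i^{e_i}` with `α`, or `ℚ^N` with any matrix of
`𝓜_{m,c}(ℤ)`, being instances).  `R`-submodules of `V` = `T`-stable subgroups, `R`-linear isomorphisms of full lattices =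
restrictions of the `ℚ`-automorphisms of `V` commuting with `T` (g38-#1 `exists_centralizer_map_eq_of_equivariant`).
* §1 **`𝓜_{m,c}(ℤ)` = the integer forms of `(V, T)`**: for `T` semisimple with `χ_T = c`, an integer matrix `B` is the
  matrix of `T` in some basis iff `B` is semisimple with `χ_B = c` (`exists_represents_iff_isSemisimple_and_charpoly_eq`)
  iff `μ_B = m ∧ χ_B = c`, `m = μ_T = rad c` (`exists_represents_iff_minpoly_eq_and_charpoly_eq`, `minpoly_eq_prod_of_isSemisimple`) — «since `m` is
  square-free then `A` is semisimple … `V = ⊕ W_i` … `W_i` must have dimension `e_i`».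
* §2 **THEOREM 8.1 ∕ 4.1** (`exists_equiv_quot_conj_quot_centralizer_of_isSemisimple`): a bijection
  `𝓜_{m,c}(ℤ)/∼_ℤ ≃ 𝓛(R, V)/≃_R`, i.e. {`B ∈ M_N(ℤ)` semisimple, `χ_B = c`}/`GL_N(ℤ)` ≃ {`T`-stable full `ℤ`-lattices
  of `V`}/`C(T)`, with `[B] ↦ [L]` whenever a `ℤ`-basis of `L` represents `B` (`A(I, w̄) = B`); the same with the printed
  description `μ_B = m, χ_B = c` (`exists_equiv_quot_conj_quot_centralizer_of_minpoly_charpoly`); equality of the class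
  numbers (`natCard_quot_conj_eq_of_isSemisimple`).
* §3 the two printed remarks: all matrices of `𝓜_{m,c}(ℤ)` are conjugate over `ℚ` (`exists_rat_conj_of_mem`), and the
  square-free case `c = m` is the case of REGULAR matrices, `μ_B = χ_B` («[LaClMD33] … treat the case `m = c`»;
  `isSemisimple_and_charpoly_eq_iff_of_squarefree`).

## References
* [Marseglia2019] S. Marseglia, J. Lond. Math. Soc. 101 (2020) 984–1007, §8 Thm. 8.1. [cite: Marseglia2019, §8 Thm. 8.1, pp. 14–15]
* [Marseglia2025ModulesOverOrders] S. Marseglia, Res. Number Theory 11 (2025), §4 Thm. 4.1. [cite: Marseglia2025ModulesOverOrders, §4 Thm. 4.1, chunk p0009]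
* [LatimerMacduffee1933] C. G. Latimer, C. C. MacDuffee, Ann. of Math. 34 (1933) 313–316; [Taussky1949] O. Taussky,
  Canad. J. Math. 1 (1949) 300–302; [HertlingLarabi2026b] C. Hertling, K. Larabi, arXiv:2602.15748, Thm. 6.2.
-/

noncomputable section

open scoped Classical
open Polynomial Module Submodule Matrix UniqueFactorizationMonoid

namespace Literature.LinearAlgebra.Matrix.LatimerMacDuffeeSemisimple

open Literature.LinearAlgebra.Matrix.LatimerMacDuffeeStableLattices

variable {V : Type*} [AddCommGroup V] [Module ℚ V] [FiniteDimensional ℚ V] {n : ℕ}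

/-! ## §1 `𝓜_{m,c}(ℤ)` = the integer forms of a semisimple `(V, T)` with `χ_T = c` -/

/-- **«Since `A` is semisimple there is a decomposition `V = W₁ ⊕ … ⊕ W_r` … `W_i` must have dimension `e_i`»: for a
SEMISIMPLE `T` with characteristic polynomial `c`, an integer matrix `B` is the matrix of `T` in some `ℚ`-basis of `V`
(an integer form of `(V, T)`, `(ℚⁿ, B) ≅ (V, T)`) iff `B` is semisimple with `χ_B = c`** — so the matrix side of
g38-#1's correspondence is exactly the set of semisimple integer matrices with characteristic polynomial `c`.
[cite: Marseglia2019, §8 Thm. 8.1 (proof, «Note that since m is square-free then A is semisimple … W_i must have dimension e_i»), pp. 14–15] -/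
theorem exists_represents_iff_isSemisimple_and_charpoly_eq {T : Module.End ℚ V} (hT : T.IsSemisimple) {c : ℤ[X]}
    (hc : T.charpoly = c.map (Int.castRingHom ℚ)) (B : Matrix (Fin n) (Fin n) ℤ) :
    (∃ b : Basis (Fin n) ℚ V, ∀ j, T (b j) = ∑ i, (B i j : ℚ) • b i) ↔
      Module.End.IsSemisimple (Matrix.toLin' (B.map (Int.castRingHom ℚ))) ∧ B.charpoly = c := by
  constructor
  · rintro ⟨b, hb⟩
    refine ⟨?_, ?_⟩
    · rw [Literature.LinearAlgebra.isSemisimple_iff_squarefree_minpoly, Matrix.minpoly_toLin',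
        minpoly_map_eq_of_represents hb]
      exact hT.minpoly_squarefree
    · refine Polynomial.map_injective (Int.castRingHom ℚ) (Int.castRingHom ℚ).injective_int ?_
      rw [charpoly_eq_of_represents hb, hc]
  · rintro ⟨hs, hB⟩
    have h : (B.map (Int.castRingHom ℚ)).charpoly = T.charpoly := by rw [Matrix.charpoly_map, hB, hc]
    obtain ⟨b, hb⟩ := Literature.LinearAlgebra.exists_basis_toMatrix_eq_of_charpoly_eq_of_isSemisimple T hT _ hs h
    exact ⟨b, (toMatrix_eq_map_iff b T B).1 hb⟩

/-- **The printed description of `𝓜_{m,c}(ℤ)`: «integral `N × N` matrices with minimal and characteristic polynomials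
`m` and `c`», `m = f₁⋯f_r ∈ ℤ[x]` square-free** — for `T` semisimple with `χ_T = c` and `μ_T = m` (necessarily
`m = rad c`, next lemma), `B` is an integer form of `(V, T)` iff `μ_B = m` and `χ_B = c`.
[cite: Marseglia2019, §8 (definition of `𝓜_{m,c}(ℤ)`) and Thm. 8.1, p. 14] [cite: Marseglia2025ModulesOverOrders, §4 (definition of `Mat_{m,h}`), chunk p0009] -/
theorem exists_represents_iff_minpoly_eq_and_charpoly_eq {T : Module.End ℚ V} (hT : T.IsSemisimple) {m c : ℤ[X]}
    (hm : minpoly ℚ T = m.map (Int.castRingHom ℚ)) (hc : T.charpoly = c.map (Int.castRingHom ℚ))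
    (B : Matrix (Fin n) (Fin n) ℤ) :
    (∃ b : Basis (Fin n) ℚ V, ∀ j, T (b j) = ∑ i, (B i j : ℚ) • b i) ↔
      minpoly ℚ (B.map (Int.castRingHom ℚ)) = m.map (Int.castRingHom ℚ) ∧ B.charpoly = c := by
  rw [exists_represents_iff_isSemisimple_and_charpoly_eq hT hc]
  constructor
  · rintro ⟨hs, hB⟩
    refine ⟨?_, hB⟩
    have h : (B.map (Int.castRingHom ℚ)).charpoly = T.charpoly := by rw [Matrix.charpoly_map, hB, hc]
    rw [← hm, ← Matrix.minpoly_toLin']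
    exact Literature.LinearAlgebra.minpoly_eq_of_charpoly_eq_of_isSemisimple hs hT
      (by rw [Matrix.charpoly_toLin', h])
  · rintro ⟨hmin, hB⟩
    refine ⟨?_, hB⟩
    rw [Literature.LinearAlgebra.isSemisimple_iff_squarefree_minpoly, Matrix.minpoly_toLin', hmin, ← hm]
    exact hT.minpoly_squarefree

/-- **«since `m` is square-free» — the minimal polynomial of the semisimple `T` with `χ_T = c` is `m = rad c`**, the
product of the distinct monic primes of `ℚ[x]` dividing `c` (= `f₁⋯f_r` for `c = ∏ f_i^{e_i}`).
[cite: Marseglia2019, §8 (first paragraph and definition of `𝓜_{m,c}(ℤ)`), p. 14] -/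
theorem minpoly_eq_prod_of_isSemisimple {T : Module.End ℚ V} (hT : T.IsSemisimple) {c : ℤ[X]}
    (hc : T.charpoly = c.map (Int.castRingHom ℚ)) :
    minpoly ℚ T = ∏ P ∈ (normalizedFactors (c.map (Int.castRingHom ℚ))).toFinset, P := by
  rw [← hc]
  convert Literature.LinearAlgebra.minpoly_eq_prod_toFinset_normalizedFactors_charpoly_of_isSemisimple T hT
  all_goals rfl

/-! ## §2 THEOREM 8.1 ∕ THEOREM 4.1 -/

/-- **MARSEGLIA'S GENERALIZED LATIMER–MACDUFFEE–TAUSSKY THEOREM (J. Lond. Math. Soc. 2020, Thm. 8.1 = ANTS XVI Thm.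
4.1).**  Let `c ∈ ℤ[x]` be monic with square-free part `m`, and let `(V, T)` be any semisimple `ℚ[x]`-module with
characteristic polynomial `c` (e.g. `K = ∏ K_i^{e_i}` with `α = Δ(x̄)`, `dim_ℚ V = N = deg c`).  There is a bijection
between `𝓜_{m,c}(ℤ)/∼_ℤ` — the `GL_N(ℤ)`-conjugacy classes (`PB = B′P`, `P` unimodular) of the integer `N × N` matrices
which are semisimple with characteristic polynomial `c` (⟺ minimal polynomial `m` and characteristic polynomial `c`,
§1) — and `𝓛(R, V)/≃_R` — the full `ℤ`-lattices `L ⊆ V` stable under `T` (i.e. `R = ℤ[x]/(m)`-modules) modulo the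
automorphisms of `V` commuting with `T` (i.e. `R`-linear isomorphism) — under which `[B] ↦ [L]` whenever `B = A(L, w̄)`
is the matrix of `T` in a `ℤ`-basis `w̄` of `L` («The association `Φ : I ↦ [A(I, w̄)]_{∼_ℤ}` induces a bijection
`Φ̃ : 𝓛(R,K)/≃_R → 𝓜_{m,c}(ℤ)/∼_ℤ`»). [cite: Marseglia2019, §8 Thm. 8.1, pp. 14–15] [cite: Marseglia2025ModulesOverOrders, §4 Thm. 4.1, chunk p0009] -/
theorem exists_equiv_quot_conj_quot_centralizer_of_isSemisimple (hn : finrank ℚ V = n) (T : Module.End ℚ V)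
    (hT : T.IsSemisimple) {c : ℤ[X]} (hc : T.charpoly = c.map (Int.castRingHom ℚ)) :
    ∃ Φ : Quot (fun B B' : {B : Matrix (Fin n) (Fin n) ℤ //
                Module.End.IsSemisimple (Matrix.toLin' (B.map (Int.castRingHom ℚ))) ∧ B.charpoly = c} =>
              ∃ P : Matrix (Fin n) (Fin n) ℤ, IsUnit P.det ∧ P * B.1 = B'.1 * P) ≃
          Quot (fun L L' : {L : Submodule ℤ V // L.IsLattice ℚ ∧ ∀ x ∈ L, T x ∈ L} =>
            ∃ φ : V ≃ₗ[ℚ] V, (φ : V →ₗ[ℚ] V) ∘ₗ T = T ∘ₗ (φ : V →ₗ[ℚ] V) ∧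
              L.1.map ((φ : V →ₗ[ℚ] V).restrictScalars ℤ) = L'.1),
      ∀ (B : {B : Matrix (Fin n) (Fin n) ℤ //
                Module.End.IsSemisimple (Matrix.toLin' (B.map (Int.castRingHom ℚ))) ∧ B.charpoly = c})
        (L : {L : Submodule ℤ V // L.IsLattice ℚ ∧ ∀ x ∈ L, T x ∈ L})
        (b : Basis (Fin n) ℚ V), span ℤ (Set.range b) = L.1 →
          (∀ j, T (b j) = ∑ i, (B.1 i j : ℚ) • b i) → Φ (Quot.mk _ B) = Quot.mk _ L := by
  obtain ⟨Φ₁, hΦ₁⟩ := exists_equiv_quot_conj_quot_centralizer hn T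
  -- `𝓜_{m,c}(ℤ)` is the set of integer forms of `(V, T)` (§1)
  let e : {B : Matrix (Fin n) (Fin n) ℤ //
        Module.End.IsSemisimple (Matrix.toLin' (B.map (Int.castRingHom ℚ))) ∧ B.charpoly = c} ≃
      {B : Matrix (Fin n) (Fin n) ℤ // ∃ b : Basis (Fin n) ℚ V, ∀ j, T (b j) = ∑ i, (B i j : ℚ) • b i} :=
    Equiv.subtypeEquivRight fun B => (exists_represents_iff_isSemisimple_and_charpoly_eq hT hc B).symm
  let Φ₀ := Quot.congr (ra := fun B B' : {B : Matrix (Fin n) (Fin n) ℤ //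
        Module.End.IsSemisimple (Matrix.toLin' (B.map (Int.castRingHom ℚ))) ∧ B.charpoly = c} =>
      ∃ P : Matrix (Fin n) (Fin n) ℤ, IsUnit P.det ∧ P * B.1 = B'.1 * P)
    (rb := fun B B' : {B : Matrix (Fin n) (Fin n) ℤ // ∃ b : Basis (Fin n) ℚ V, ∀ j, T (b j) = ∑ i, (B i j : ℚ) • b i} =>
      ∃ P : Matrix (Fin n) (Fin n) ℤ, IsUnit P.det ∧ P * B.1 = B'.1 * P) e (fun _ _ => Iff.rfl)
  refine ⟨Φ₀.trans Φ₁, fun B L b hb hrep => ?_⟩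
  rw [Equiv.trans_apply]
  change Φ₁ (Quot.congr e _ (Quot.mk _ B)) = _
  rw [Quot.congr_mk]
  exact hΦ₁ (e B) L b hb hrep

/-- **The same with the printed description of `𝓜_{m,c}(ℤ)`** — matrices with minimal polynomial `m` (that of `T`,
`= rad c`) and characteristic polynomial `c`. [cite: Marseglia2019, §8 Thm. 8.1, pp. 14–15] [cite: Marseglia2025ModulesOverOrders, §4 Thm. 4.1, chunk p0009] -/
theorem exists_equiv_quot_conj_quot_centralizer_of_minpoly_charpoly (hn : finrank ℚ V = n) (T : Module.End ℚ V)
    (hT : T.IsSemisimple) {m c : ℤ[X]} (hm : minpoly ℚ T = m.map (Int.castRingHom ℚ))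
    (hc : T.charpoly = c.map (Int.castRingHom ℚ)) :
    ∃ Φ : Quot (fun B B' : {B : Matrix (Fin n) (Fin n) ℤ //
                minpoly ℚ (B.map (Int.castRingHom ℚ)) = m.map (Int.castRingHom ℚ) ∧ B.charpoly = c} =>
              ∃ P : Matrix (Fin n) (Fin n) ℤ, IsUnit P.det ∧ P * B.1 = B'.1 * P) ≃
          Quot (fun L L' : {L : Submodule ℤ V // L.IsLattice ℚ ∧ ∀ x ∈ L, T x ∈ L} =>
            ∃ φ : V ≃ₗ[ℚ] V, (φ : V →ₗ[ℚ] V) ∘ₗ T = T ∘ₗ (φ : V →ₗ[ℚ] V) ∧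
              L.1.map ((φ : V →ₗ[ℚ] V).restrictScalars ℤ) = L'.1),
      ∀ (B : {B : Matrix (Fin n) (Fin n) ℤ //
                minpoly ℚ (B.map (Int.castRingHom ℚ)) = m.map (Int.castRingHom ℚ) ∧ B.charpoly = c})
        (L : {L : Submodule ℤ V // L.IsLattice ℚ ∧ ∀ x ∈ L, T x ∈ L})
        (b : Basis (Fin n) ℚ V), span ℤ (Set.range b) = L.1 →
          (∀ j, T (b j) = ∑ i, (B.1 i j : ℚ) • b i) → Φ (Quot.mk _ B) = Quot.mk _ L := by
  obtain ⟨Φ₁, hΦ₁⟩ := exists_equiv_quot_conj_quot_centralizer hn T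
  let e : {B : Matrix (Fin n) (Fin n) ℤ //
        minpoly ℚ (B.map (Int.castRingHom ℚ)) = m.map (Int.castRingHom ℚ) ∧ B.charpoly = c} ≃
      {B : Matrix (Fin n) (Fin n) ℤ // ∃ b : Basis (Fin n) ℚ V, ∀ j, T (b j) = ∑ i, (B i j : ℚ) • b i} :=
    Equiv.subtypeEquivRight fun B => (exists_represents_iff_minpoly_eq_and_charpoly_eq hT hm hc B).symm
  let Φ₀ := Quot.congr (ra := fun B B' : {B : Matrix (Fin n) (Fin n) ℤ //
        minpoly ℚ (B.map (Int.castRingHom ℚ)) = m.map (Int.castRingHom ℚ) ∧ B.charpoly = c} =>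
      ∃ P : Matrix (Fin n) (Fin n) ℤ, IsUnit P.det ∧ P * B.1 = B'.1 * P)
    (rb := fun B B' : {B : Matrix (Fin n) (Fin n) ℤ // ∃ b : Basis (Fin n) ℚ V, ∀ j, T (b j) = ∑ i, (B i j : ℚ) • b i} =>
      ∃ P : Matrix (Fin n) (Fin n) ℤ, IsUnit P.det ∧ P * B.1 = B'.1 * P) e (fun _ _ => Iff.rfl)
  refine ⟨Φ₀.trans Φ₁, fun B L b hb hrep => ?_⟩
  rw [Equiv.trans_apply]
  change Φ₁ (Quot.congr e _ (Quot.mk _ B)) = _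
  rw [Quot.congr_mk]
  exact hΦ₁ (e B) L b hb hrep

/-- **«bijection»: `#(𝓜_{m,c}(ℤ)/∼_ℤ) = #(𝓛(R, V)/≃_R)`** (as `Nat.card`, both `0` if infinite — they are in fact finite,
Jordan–Zassenhaus, sequel row). [cite: Marseglia2019, §8 Thm. 8.1, pp. 14–15] -/
theorem natCard_quot_conj_eq_of_isSemisimple (hn : finrank ℚ V = n) (T : Module.End ℚ V) (hT : T.IsSemisimple)
    {c : ℤ[X]} (hc : T.charpoly = c.map (Int.castRingHom ℚ)) :
    Nat.card (Quot (fun B B' : {B : Matrix (Fin n) (Fin n) ℤ //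
                Module.End.IsSemisimple (Matrix.toLin' (B.map (Int.castRingHom ℚ))) ∧ B.charpoly = c} =>
              ∃ P : Matrix (Fin n) (Fin n) ℤ, IsUnit P.det ∧ P * B.1 = B'.1 * P)) =
      Nat.card (Quot (fun L L' : {L : Submodule ℤ V // L.IsLattice ℚ ∧ ∀ x ∈ L, T x ∈ L} =>
            ∃ φ : V ≃ₗ[ℚ] V, (φ : V →ₗ[ℚ] V) ∘ₗ T = T ∘ₗ (φ : V →ₗ[ℚ] V) ∧
              L.1.map ((φ : V →ₗ[ℚ] V).restrictScalars ℤ) = L'.1)) := by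
  obtain ⟨Φ, -⟩ := exists_equiv_quot_conj_quot_centralizer_of_isSemisimple hn T hT hc
  exact Nat.card_congr Φ

/-! ## §3 The printed remarks: rational conjugacy inside `𝓜_{m,c}(ℤ)`; the case `c = m` -/

/-- **All matrices of `𝓜_{m,c}` are conjugate over the FIELD** (semisimple with the same characteristic polynomial),
although «the converse is not true in general» over `ℤ` — Theorem 8.1 counts the `GL_N(ℤ)`-classes inside one
`GL_N(ℚ)`-class. [cite: Marseglia2019, §8 (first paragraph, «The converse is not true in general»), p. 14] -/
theorem exists_rat_conj_of_mem {N : Type*} [Fintype N] [DecidableEq N] {c : ℤ[X]} {B B' : Matrix N N ℤ}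
    (hB : Module.End.IsSemisimple (Matrix.toLin' (B.map (Int.castRingHom ℚ))) ∧ B.charpoly = c)
    (hB' : Module.End.IsSemisimple (Matrix.toLin' (B'.map (Int.castRingHom ℚ))) ∧ B'.charpoly = c) :
    ∃ S : Matrix N N ℚ, IsUnit S ∧ B'.map (Int.castRingHom ℚ) = S * B.map (Int.castRingHom ℚ) * S⁻¹ := by
  refine (Literature.LinearAlgebra.Matrix.exists_isUnit_conj_iff_charpoly_eq_of_isSemisimple _ _ hB.1 hB'.1).2 ?_
  rw [Matrix.charpoly_map, Matrix.charpoly_map, hB.2, hB'.2]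

/-- **The case `c = m` of [LaClMD33] ∕ [taussky49]**: when `c` itself is square-free (over `ℚ`), «semisimple with
`χ_B = c`» is just «`χ_B = c`», and then `μ_B = χ_B` (the matrices are regular — the tree's
`LatimerMacDuffeeSquarefree.minpoly_map_eq_of_charpoly_eq`). [cite: Marseglia2019, §8 («[LaClMD33], where the authors treat the case m = c»), p. 14] -/
theorem isSemisimple_and_charpoly_eq_iff_of_squarefree {N : Type*} [Fintype N] [DecidableEq N] {c : ℤ[X]}
    (hc : Squarefree (c.map (Int.castRingHom ℚ))) (B : Matrix N N ℤ) :
    (Module.End.IsSemisimple (Matrix.toLin' (B.map (Int.castRingHom ℚ))) ∧ B.charpoly = c) ↔ B.charpoly = c := by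
  refine ⟨fun h => h.2, fun h => ⟨?_, h⟩⟩
  rw [Literature.LinearAlgebra.isSemisimple_iff_squarefree_minpoly, Matrix.minpoly_toLin']
  refine Squarefree.squarefree_of_dvd ?_ hc
  rw [← h, ← Matrix.charpoly_map]
  exact Matrix.minpoly_dvd_charpoly _

end Literature.LinearAlgebra.Matrix.LatimerMacDuffeeSemisimple
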